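import Mathlib
import HarnessLib
import Summits.SmoothPoincare4.SmoothPoincare4.Theses.ZeroSurgeryExotic
import Literature.Topology.FourManifolds.LeeRasmussen

/-!
# Sketch — crux-ideate stmt-SmoothPoincare4-0364 (ZseThesis), ideator 3, round 1

First lemmas of the two idea cards `sandwich-slack` and `finite-friend-rays`.
Everything here is glue over existing declarations; the mathematics of the lines
(Lipshitz–Sarkar / Dunfield–Lipshitz–Schütz refinements, MMSW finite approximation)
enters only as hypotheses (structures) — no new named facts are declared.
-/

noncomputable section

open scoped Manifold ContDiff
open Literature.Topology.FourManifolds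

namespace Summit.SmoothPoincare4.SmoothPoincare4.Cruxes.ZseThesis.Ideator3

/-- A **sandwich-free slice obstruction**: any integer-valued knot invariant that vanishes on
smoothly slice knots (e.g. Rasmussen `s`, the Lipshitz–Sarkar refinements `s^{Sq²}_±`,
the `ℤ/2`-valued LEO invariant `s̃_c` of Dunfield–Lipshitz–Schütz read in `ℤ`). -/
structure SliceObstruction where
  /-- the invariant -/
  v : Knot → ℤ
  /-- it vanishes on smoothly slice knots -/
  eq_zero_of_isSmoothlySlice : ∀ K : Knot, K.IsSmoothlySlice → v K = 0

/-- An **upper refinement of Rasmussen's invariant** (card `sandwich-slack`): a slice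
obstruction `r` with `s(K) ≤ r(K) ≤ s(K) + 2` for every knot — the shape of
`s^{Sq²}_+` (Lipshitz–Sarkar 2014, Thm 1 / Cor 5.?) and of the LEO refinements
(Dunfield–Lipshitz–Schütz, Remark 6.? : values in `{(0,0),(2,0),(0,-2)}`). -/
structure UpperRefinement extends SliceObstruction where
  /-- one-sided sandwich: `s ≤ r ≤ s + 2` -/
  sandwich : ∀ (K : Knot) (s : ℤ), K.HasRasmussenInvariant s → s ≤ v K ∧ v K ≤ s + 2

/-- **Card A, first lemma (`zseThesis_of_refinedWitness`).** The parent crux does not name the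
witness invariant: a 0-surgery pair `(K, K′)` with `K` smoothly slice and ANY slice obstruction
nonzero on `K′` proves `ZseThesis`. -/
theorem zseThesis_of_refinedWitness (ρ : SliceObstruction)
    (h : ∃ (K K' : Knot) (Y : Type) (_ : TopologicalSpace Y)
        (_ : ChartedSpace (EuclideanSpace ℝ (Fin 3)) Y),
        IsIntegralSurgery (𝓡 3) Y K 0 ∧ IsIntegralSurgery (𝓡 3) Y K' 0 ∧
        K.IsSmoothlySlice ∧ ρ.v K' ≠ 0) :
    Theses.ZeroSurgeryExotic.ZseThesis := by
  obtain ⟨K, K', Y, tY, cY, h1, h2, h3, h4⟩ := h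
  exact ⟨K, K', Y, tY, cY, h1, h2, h3, fun hs => h4 (ρ.eq_zero_of_isSmoothlySlice K' hs)⟩

/-- **Card A, the slack (`sandwich_slack`).** Where the forced-vanishing theorems bite
(`s(K′) = 0`, e.g. `K′` H-slice in both punctured `#ⁿℂℙ²` and `#ⁿℂℙ²bar` — Nakamura 2023
Thm 3.13 / Dunfield–Gong Thm 5.9), an upper refinement is squeezed from ONE side only:
`r(K′) ∈ {0, 1, 2}`; nothing forces `r(K′) = 0`. -/
theorem sandwich_slack (ρ : UpperRefinement) (K : Knot) (h0 : K.HasRasmussenInvariant 0) :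
    0 ≤ ρ.v K ∧ ρ.v K ≤ 2 := by
  simpa using ρ.sandwich K 0 h0

/-- **Card B, first lemma (`zseThesis_of_ray`).** A `ℤ`-indexed ray of knots with a common
0-surgery `Y` (a friend ray, e.g. Rolfsen twists along a 0-slice circle, or Osoinach annulus
twists), slice at `n = 0`, carrying a nonzero slice obstruction anywhere, proves `ZseThesis`. -/
theorem zseThesis_of_ray (ρ : SliceObstruction) (J : ℤ → Knot) (Y : Type) [TopologicalSpace Y]
    [ChartedSpace (EuclideanSpace ℝ (Fin 3)) Y]
    (hY : ∀ n : ℤ, IsIntegralSurgery (𝓡 3) Y (J n) 0) (h0 : (J 0).IsSmoothlySlice)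
    (n : ℤ) (hn : ρ.v (J n) ≠ 0) :
    Theses.ZeroSurgeryExotic.ZseThesis :=
  zseThesis_of_refinedWitness ρ ⟨J 0, J n, Y, inferInstance, inferInstance, hY 0, hY n, h0, hn⟩

/-- **Card B, ray decision (`ray_witness_iff`).** Pure order theory behind "a friend ray is
decided by two numbers": if `s ∘ J` is antitone in the twist parameter (MMSW 2023 Thm 1.11,
generalized crossing changes), vanishes at `0` (`J 0` slice, Rasmussen), and has constant tails
`a` for `n ≥ N` and `b` for `n ≤ -N` (MMSW Thm 1.4: finite approximation, `a = s₋(J ⊂ S¹×S²)`,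
`b = s₊(J ⊂ S¹×S²)`, `N = ⌈(n⁺+2)/2⌉`), then the ray carries an `s`-witness iff `a < 0 ∨ 0 < b`. -/
theorem ray_witness_iff (s : ℤ → ℤ) (hs : Antitone s) (h0 : s 0 = 0) (a b : ℤ) (N : ℕ)
    (ha : ∀ n : ℤ, (N : ℤ) ≤ n → s n = a) (hb : ∀ n : ℤ, n ≤ -(N : ℤ) → s n = b) :
    (∃ n, s n ≠ 0) ↔ (a < 0 ∨ 0 < b) := by
  constructor
  · rintro ⟨n, hn⟩
    rcases le_or_gt 0 n with h | h
    · -- n ≥ 0: s n ≤ s 0 = 0, and s n ≠ 0, so s n < 0; then a = s (max n N) ≤ s n < 0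
      have h1 : s n ≤ 0 := h0 ▸ hs h
      have h2 : s n < 0 := lt_of_le_of_ne h1 hn
      left
      have hle : n ≤ max n (N : ℤ) := le_max_left _ _
      have h3 : s (max n (N : ℤ)) ≤ s n := hs hle
      have h4 : s (max n (N : ℤ)) = a := ha _ (le_max_right _ _)
      omega
    · have h1 : 0 ≤ s n := h0 ▸ hs h.le
      have h2 : 0 < s n := lt_of_le_of_ne h1 (Ne.symm hn)
      right
      have hle : min n (-(N : ℤ)) ≤ n := min_le_left _ _
      have h3 : s n ≤ s (min n (-(N : ℤ))) := hs hle
      have h4 : s (min n (-(N : ℤ))) = b := hb _ (min_le_right _ _)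
      omega
  · rintro (h | h)
    · exact ⟨(N : ℤ), by rw [ha _ le_rfl]; omega⟩
    · exact ⟨-(N : ℤ), by rw [hb _ le_rfl]; omega⟩

end Summit.SmoothPoincare4.SmoothPoincare4.Cruxes.ZseThesis.Ideator3

end
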